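/-
Copyright (c) 2026 the pub-hodgecm-mathlib formalisation cell (harness21).  Prover seat hodgecm-mathlib-K2E3-p23 (g8), Track B «K2-LIT» ∕ hLiu418, organ F4 (G-gen),
B3-b FILE 3 «FINAL PASSAGE» (LEAD F0P6-plan (g14) BATCH #158 (1), 2026-09-04T23:39:27Z; cut LH7-p07 (g2) 23:37:54Z (D)).  THEOREMS ONLY.
-/
import Summits.HodgeConjecture.HodgeConjecture.Theorems.K2LiuFaceGLetterDefs     -- ★ p862888: `IsArchStable`, `genFamily` (the letters' predicates of record)
import HarnessLib

/-!
# Crux `HLiu418`, organ F4 (G-gen), B3-b FILE 3 «FINAL PASSAGE»: FROM `Good` ON A GENERATING FAMILY OF ARCH VECTORS TO `Good` ON EVERY RIGIDITY DOMAIN `D_V`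

Cell `hodgecm-mathlib`, crux item hLiu418 = `stmt-HodgeConjecture-24832` (helper lane `--kind proof --supports stmt-HodgeConjecture-24832 --as helper`, count-neutral;
closes no socket); squad K2 ∕ K2Liu; LEAD F0P6-plan (g14); F4 lead K2Liu-p27 (g2); B3-b writer LH7-p07 (g2) (FILE 1 `K2LiuArchSWDataTuplesDefs`, FILE 2
`K2LiuArchSWDataInduction`); box K2E5-r02 (g6).  THEOREMS ONLY (no `def`, no `instance`, no notation, no named-fact hypothesis, no `sorry`).

WHAT.  K2Liu-p10 (g6)'s FACE-G letter L3 `hGgen` (★ p862960 `K2LiuFaceGAssembler.faceG_of_organs`, binder :170–233) concludes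
`∀ V (fd) (arch-stable), ∀ x ∈ D_V, Good V x`, where `D_V = span {E(a ⊗ f) : a ∈ V, f}` (`E = piSchwartzBruhatEquiv`).  B3-b proves it through the TUPLE CURRENCY
(★ B3-core p863061 `forall_tuple_of_fockLetters` ⇒ `Good` at every `E(tupleVec a ⊗ f)`).  THIS FILE is the last, purely linear step, typed GENERICALLY in the
generating family so that it needs nothing of FILE 1 ∕ FILE 2 and nothing of the (E-g) analysis: given a family `t : B → 𝓢_∞` of arch vectors («the tuple vectors» ∕
«the Hermite vectors of the big frame») such that
* (dom)     every finite sub-family of `t` lies in SOME finite-dimensional arch-stable `V′` (the degree ledger: Hermite spans);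
* (partner) every `a ∈ V` (`V` finite-dimensional, arch-stable) has, for each `f`, a partner `w ∈ span (range t)` with the SAME generator family
            `g_{E(w ⊗ f)} = g_{E(a ⊗ f)}` — the (E-g) «polynomial partner» BY VALUE (★ (E-g-core) p863009 ∘ (E-g-an) ∘ ★ (E-g-fin) p863082, in p10's `genFamily` form);
* (gen)     `Good V′ ⟨E(t β ⊗ f), _⟩` for every `β`, `f` and every admissible `V′` whose domain contains it (= FILE 2's `Good_f` at `t := tupleVec`);
and `hGgen`'s own closure letters (congr)(zero)(add)(smul) BYTES VERBATIM, then `Good V x` for every admissible `V` and every `x ∈ D_V`.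
PROOF.  `Submodule.span_induction` on `x ∈ D_V` ((zero)(add)(smul) inside `V`); a generator `E(a ⊗ f)` is moved by (congr) to its partner `E(w ⊗ f)`,
`w = Σ_{β ∈ s} c_β • t β` (`Finsupp.mem_span_range_iff_exists_finsupp`), which lives in `D_{V′}` for the (dom) space `V′ ⊇ t(s)` and is `Good` there by
(gen) + (zero)(add)(smul) inside `V′` (`Finset.sum_induction` on the predicate «`∃ h : y ∈ D_{V′}, Good V′ ⟨y, h⟩`»).
* §1 **`forall_good_of_generators`** — the module-theoretic skeleton (any semiring, any `E : M → F → X` additive and homogeneous in the arch slot, admissibility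
  `Adm`, reading `g`); `apply_sum_smul_eq`, **`sum_smul_mem_and_good`** — its summation step.
* §2 **`forall_domain_good_of_archGenerators`** — the same in the letters of record (`IsArchStable`, `genFamily`, `piSchwartzBruhatEquiv`, `FinSB`): hypotheses
  (congr)(zero)(add)(smul) = `hGgen`'s binders verbatim, conclusion = `hGgen`'s conclusion verbatim; the three new letters (dom)(partner)(gen) are FILE 2's to
  discharge (at `t := tupleVec`, or `t := follandHermite frameD` through FILE 1's glue).
References: [Howe1989] §3 (Fock-finite vectors, polynomial Fock model); [KudlaRallis1994] §3; [Folland1989] §1.7 (Hermite expansions) — citations only, the file is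
linear algebra.
HONEST LABEL.  Count-neutral helper; `HC_CM` is proved only modulo the 7 printed citations (2 remaining named inputs: hLiu418 = `stmt-HodgeConjecture-24832`,
h413 = `stmt-HodgeConjecture-24833`) until rung 0 closes.
-/

set_option autoImplicit false
set_option linter.dupNamespace false -- the mandated namespace repeats `HodgeConjecture.HodgeConjecture`

noncomputable section

namespace Summit.HodgeConjecture.HodgeConjecture.Cruxes.HLiu418.K2LiuArchSWDataFinalPassage

/-! ## §1 The module-theoretic skeleton -/
section Generic

variable {𝕜 : Type*} [Semiring 𝕜] {M : Type*} [AddCommMonoid M] [Module 𝕜 M] {F : Type*} {X : Type*} [AddCommMonoid X] [Module 𝕜 X] {Y : Type*}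
  (E : M → F → X) (Adm : Submodule 𝕜 M → Prop) (g : X → Y)
  (Good : (V : Submodule 𝕜 M) → ↥(Submodule.span 𝕜 {x : X | ∃ a ∈ V, ∃ f : F, x = E a f}) → Prop)
  {B : Type*} (t : B → M)

/-- **`E` passes finite linear combinations through the arch slot**: `E (Σ_{β∈s} c β • t β) f = Σ_{β∈s} c β • E (t β) f` for `E` additive and homogeneous
in its first argument. [folklore] -/
theorem apply_sum_smul_eq
    (hEadd : ∀ (a b : M) (f : F), E (a + b) f = E a f + E b f) (hEsmul : ∀ (c : 𝕜) (a : M) (f : F), E (c • a) f = c • E a f)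
    (f : F) (c : B → 𝕜) (s : Finset B) : E (∑ β ∈ s, c β • t β) f = ∑ β ∈ s, c β • E (t β) f := by
  have hE0 : E 0 f = 0 := by
    have h := hEsmul 0 0 f
    rwa [zero_smul, zero_smul] at h
  induction s using Finset.cons_induction with
  | empty => rw [Finset.sum_empty, Finset.sum_empty, hE0]
  | cons β s hβ ih => rw [Finset.sum_cons, Finset.sum_cons, hEadd, hEsmul, ih]

/-- **SUMMATION STEP.**  If `Good V′` is closed under `0, +, •` and holds at every generator `E (t β) f` whose `t β` lies in `V′`, then for every finite `s` with
`t(s) ⊆ V′` and all coefficients `c`, the vector `Σ_{β∈s} c β • E (t β) f` lies in `D_{V′}` and is `Good` there (`Finset.sum_induction` on the predicate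
«`∃ h : y ∈ D_{V′}, Good V′ ⟨y, h⟩`»). [cite: Howe1989, §3] -/
theorem sum_smul_mem_and_good
    (hzero : ∀ V, Adm V → Good V 0)
    (hadd : ∀ V, Adm V → ∀ x y : ↥(Submodule.span 𝕜 {x : X | ∃ a ∈ V, ∃ f : F, x = E a f}), Good V x → Good V y → Good V (x + y))
    (hsmul : ∀ V, Adm V → ∀ (c : 𝕜) (x : ↥(Submodule.span 𝕜 {x : X | ∃ a ∈ V, ∃ f : F, x = E a f})), Good V x → Good V (c • x))
    (hgen : ∀ (β : B) (f : F) (V' : Submodule 𝕜 M), Adm V' → ∀ hx : E (t β) f ∈ Submodule.span 𝕜 {x : X | ∃ a ∈ V', ∃ f : F, x = E a f}, Good V' ⟨E (t β) f, hx⟩)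
    (V' : Submodule 𝕜 M) (hV' : Adm V') (f : F) (s : Finset B) (hs : ∀ β ∈ s, t β ∈ V') (c : B → 𝕜) :
    ∃ hx : (∑ β ∈ s, c β • E (t β) f) ∈ Submodule.span 𝕜 {x : X | ∃ a ∈ V', ∃ f : F, x = E a f}, Good V' ⟨∑ β ∈ s, c β • E (t β) f, hx⟩ := by
  refine Finset.sum_induction (fun β => c β • E (t β) f)
    (fun y => ∃ hx : y ∈ Submodule.span 𝕜 {x : X | ∃ a ∈ V', ∃ f : F, x = E a f}, Good V' ⟨y, hx⟩) ?_ ?_ ?_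
  · rintro y z ⟨hy, hGy⟩ ⟨hz, hGz⟩
    exact ⟨add_mem hy hz, hadd V' hV' ⟨y, hy⟩ ⟨z, hz⟩ hGy hGz⟩
  · exact ⟨zero_mem _, hzero V' hV'⟩
  · intro β hβ
    have hgenβ : E (t β) f ∈ Submodule.span 𝕜 {x : X | ∃ a ∈ V', ∃ f : F, x = E a f} :=
      Submodule.subset_span ⟨t β, hs β hβ, f, rfl⟩
    exact ⟨Submodule.smul_mem _ _ hgenβ, hsmul V' hV' (c β) ⟨E (t β) f, hgenβ⟩ (hgen β f V' hV' hgenβ)⟩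

/-- **THE FINAL PASSAGE, GENERIC FORM.**  Let `Good V x` (`x ∈ D_V = span {E a f : a ∈ V}`) be a property which (congr) reads `x` only through `g x`, and is
closed under `0, +, •` inside every admissible `V`.  If (dom) every finite part of a family `t` lies in some admissible `V′`, (partner) every `a ∈ V` (`V`
admissible) has for each `f` a partner `w ∈ span (range t)` with `g (E w f) = g (E a f)`, and (gen) `Good` holds at every generator `E (t β) f` of every admissible
domain containing it, then `Good V x` for every admissible `V` and every `x ∈ D_V`. [cite: Howe1989, §3] [cite: KudlaRallis1994, §3] -/
theorem forall_good_of_generators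
    (hEadd : ∀ (a b : M) (f : F), E (a + b) f = E a f + E b f) (hEsmul : ∀ (c : 𝕜) (a : M) (f : F), E (c • a) f = c • E a f)
    (hcongr : ∀ (V V' : Submodule 𝕜 M) (x : ↥(Submodule.span 𝕜 {x : X | ∃ a ∈ V, ∃ f : F, x = E a f}))
      (x' : ↥(Submodule.span 𝕜 {x : X | ∃ a ∈ V', ∃ f : F, x = E a f})), g (x : X) = g (x' : X) → Good V x → Good V' x')
    (hzero : ∀ V, Adm V → Good V 0)
    (hadd : ∀ V, Adm V → ∀ x y : ↥(Submodule.span 𝕜 {x : X | ∃ a ∈ V, ∃ f : F, x = E a f}), Good V x → Good V y → Good V (x + y))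
    (hsmul : ∀ V, Adm V → ∀ (c : 𝕜) (x : ↥(Submodule.span 𝕜 {x : X | ∃ a ∈ V, ∃ f : F, x = E a f})), Good V x → Good V (c • x))
    (hdom : ∀ s : Finset B, ∃ V' : Submodule 𝕜 M, Adm V' ∧ ∀ β ∈ s, t β ∈ V')
    (hpartner : ∀ V, Adm V → ∀ a ∈ V, ∀ f : F, ∃ w ∈ Submodule.span 𝕜 (Set.range t), g (E w f) = g (E a f))
    (hgen : ∀ (β : B) (f : F) (V' : Submodule 𝕜 M), Adm V' → ∀ hx : E (t β) f ∈ Submodule.span 𝕜 {x : X | ∃ a ∈ V', ∃ f : F, x = E a f}, Good V' ⟨E (t β) f, hx⟩)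
    (V : Submodule 𝕜 M) (hV : Adm V) (x : ↥(Submodule.span 𝕜 {x : X | ∃ a ∈ V, ∃ f : F, x = E a f})) : Good V x := by
  obtain ⟨x, hx⟩ := x
  induction hx using Submodule.span_induction with
  | mem y hy =>
    obtain ⟨a, ha, f, rfl⟩ := hy
    -- the partner `w = Σ_{β ∈ s} c β • t β`, good on the (dom) space `V′ ⊇ t(s)`, transported back by (congr)
    obtain ⟨w, hw, hgw⟩ := hpartner V hV a ha f
    obtain ⟨c, rfl⟩ := (Finsupp.mem_span_range_iff_exists_finsupp).1 hw
    obtain ⟨V', hV', hs⟩ := hdom c.support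
    obtain ⟨hx', hG'⟩ := sum_smul_mem_and_good E Adm Good t hzero hadd hsmul hgen V' hV' f c.support hs c
    have hsum : E (c.sum fun β r => r • t β) f = ∑ β ∈ c.support, c β • E (t β) f :=
      apply_sum_smul_eq E t hEadd hEsmul f c c.support
    rw [hsum] at hgw
    exact hcongr V' V ⟨_, hx'⟩ ⟨E a f, Submodule.subset_span ⟨a, ha, f, rfl⟩⟩ hgw hG'
  | zero => exact hzero V hV
  | add y z hy hz ihy ihz => exact hadd V hV ⟨y, hy⟩ ⟨z, hz⟩ ihy ihz
  | smul r y hy ih => exact hsmul V hV r ⟨y, hy⟩ ih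

end Generic

/-! ## §2 In the letters of record (`hGgen` currency) -/
section Letters

open scoped TensorProduct SchwartzMap Classical  -- `Classical`: the `Fintype` of real ∕ complex places inside `mixedSpace (L⁺)` (as ★ `K2LiuFaceGAssembler`)
open NumberField NumberField.mixedEmbedding
open Literature.NumberTheory.Automorphic Literature.NumberTheory.Automorphic.UnitaryGroup Literature.NumberTheory.GaloisRepresentations
open Literature.NumberTheory.GelbartRogawski1991 Literature.NumberTheory.GelbartRogawski1991.GRConstruction
open Literature.NumberTheory.GelbartRogawski1991.UnitaryDualPair
open Literature.NumberTheory.K2Lit.SiegelDoubled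
open Literature.NumberTheory.Automorphic.Liu2021
open Literature.NumberTheory.Automorphic.Liu2021.Def411WeilCarriers
open Literature.NumberTheory.Automorphic.Liu2021.Def411WeilCarriersDoubling
open Literature.NumberTheory.Weil1964
open Literature.RepresentationTheory.Liu2021
open K2LiuFaceGLetterDefs (IsArchStable genFamily)

variable (L : Type) [Field L] [NumberField L] [IsCMField L] {n : ℕ} (e : Fin 2 × Fin 1 ≃ Fin n)
  (dV : Fin 2 → L) (hdV : ∀ i, IsCMField.complexConj L (dV i) = dV i) (hdV0 : ∀ i, dV i ≠ 0)
  (dW : Fin 1 → L) (hdW : ∀ i, IsCMField.complexConj L (dW i) = dW i) (hdW0 : ∀ i, dW i ≠ 0)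
  {M' n' : ℕ} (eW : Fin 1 × Fin 3 ≃ Fin M') (e' : Fin 2 × Fin M' ≃ Fin n')
  (dV' : Fin 3 → L) (hdV' : ∀ k, IsCMField.complexConj L (dV' k) = dV' k) (hdV'0 : ∀ k, dV' k ≠ 0)
  (χb : HeckeCharacter L) (hχbu : χb.IsUnitary) (hχbs : Literature.RepresentationTheory.HarrisKudlaSweet1996.IsSplittingChar L 1 χb)
  (α : UnitaryGroup.adelicOne (Fp L) L (IsCMField.complexConj L) →* ℂˣ) (𝒦 : IwasawaDatum L e dV hdV dW hdW)

/-- **B3-b FILE 3 — THE FINAL PASSAGE IN THE LETTERS OF RECORD.**  For a property `Good V x` of admissible data (`x ∈ D_V = span {E(a ⊗ f) : a ∈ V}`,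
`E = piSchwartzBruhatEquiv`) satisfying `hGgen`'s closure letters (congr)(zero)(add)(smul) (bytes of ★ `faceG_of_organs`' binder), and a family `t : B → 𝓢_∞` of arch
vectors with (dom) every finite part inside some finite-dimensional arch-stable `V′`, (partner) every `a ∈ V` matched for each `f` by some `w ∈ span (range t)`
with `g_{E(w ⊗ f)} = g_{E(a ⊗ f)}` (the (E-g) polynomial partner by value, `genFamily` form), (gen) `Good` at every `E(t β ⊗ f)`: `Good V x` for every
finite-dimensional arch-stable `V` and every `x ∈ D_V` — `hGgen`'s conclusion verbatim. [cite: Howe1989, §3] [cite: KudlaRallis1994, §3] [cite: Folland1989, §1.7] -/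
theorem forall_domain_good_of_archGenerators
    (Good : (V : Submodule ℂ 𝓢(((Fin (n' + n')) → mixedSpace (Fp L)), ℂ)) → ↥(Submodule.span ℂ {x : piSchwartzBruhat (Fp L) (Fin (n' + n')) |
          ∃ a ∈ V, ∃ f : FinSB (Fp L) (Fin (n' + n')), x = piSchwartzBruhatEquiv (Fp L) (Fin (n' + n')) (a ⊗ₜ[ℂ] f)}) → Prop)
    -- (congr) `Good` reads the datum only through its twisted Siegel–Weil generator family `g_x` (★ `hGgen` bytes)
    (hcongr : ∀ (V V' : Submodule ℂ 𝓢(((Fin (n' + n')) → mixedSpace (Fp L)), ℂ)) (x : ↥(Submodule.span ℂ {x : piSchwartzBruhat (Fp L) (Fin (n' + n')) |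
          ∃ a ∈ V, ∃ f : FinSB (Fp L) (Fin (n' + n')), x = piSchwartzBruhatEquiv (Fp L) (Fin (n' + n')) (a ⊗ₜ[ℂ] f)})) (x' : ↥(Submodule.span ℂ {x : piSchwartzBruhat (Fp L) (Fin (n' + n')) |
          ∃ a ∈ V', ∃ f : FinSB (Fp L) (Fin (n' + n')), x = piSchwartzBruhatEquiv (Fp L) (Fin (n' + n')) (a ⊗ₜ[ℂ] f)})),
      genFamily L e dV hdV hdV0 dW hdW hdW0 eW e' dV' hdV' hdV'0 χb hχbu hχbs α 𝒦 (x : piSchwartzBruhat (Fp L) (Fin (n' + n'))) =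
        genFamily L e dV hdV hdV0 dW hdW hdW0 eW e' dV' hdV' hdV'0 χb hχbu hχbs α 𝒦 (x' : piSchwartzBruhat (Fp L) (Fin (n' + n'))) → Good V x → Good V' x')
    -- (zero) (add) (smul) (★ `hGgen` bytes)
    (hzero : ∀ (V : Submodule ℂ 𝓢(((Fin (n' + n')) → mixedSpace (Fp L)), ℂ)), FiniteDimensional ℂ V → IsArchStable L e dV hdV hdV0 dW hdW hdW0 eW e' dV' hdV' hdV'0 χb hχbu hχbs 𝒦 V → Good V 0)
    (hadd : ∀ (V : Submodule ℂ 𝓢(((Fin (n' + n')) → mixedSpace (Fp L)), ℂ)), FiniteDimensional ℂ V → IsArchStable L e dV hdV hdV0 dW hdW hdW0 eW e' dV' hdV' hdV'0 χb hχbu hχbs 𝒦 V →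
      ∀ x y : ↥(Submodule.span ℂ {x : piSchwartzBruhat (Fp L) (Fin (n' + n')) |
          ∃ a ∈ V, ∃ f : FinSB (Fp L) (Fin (n' + n')), x = piSchwartzBruhatEquiv (Fp L) (Fin (n' + n')) (a ⊗ₜ[ℂ] f)}), Good V x → Good V y → Good V (x + y))
    (hsmul : ∀ (V : Submodule ℂ 𝓢(((Fin (n' + n')) → mixedSpace (Fp L)), ℂ)), FiniteDimensional ℂ V → IsArchStable L e dV hdV hdV0 dW hdW hdW0 eW e' dV' hdV' hdV'0 χb hχbu hχbs 𝒦 V →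
      ∀ (c : ℂ) (x : ↥(Submodule.span ℂ {x : piSchwartzBruhat (Fp L) (Fin (n' + n')) |
          ∃ a ∈ V, ∃ f : FinSB (Fp L) (Fin (n' + n')), x = piSchwartzBruhatEquiv (Fp L) (Fin (n' + n')) (a ⊗ₜ[ℂ] f)})), Good V x → Good V (c • x))
    -- the generating family and its three letters (dom) (partner) (gen)
    {B : Type*} (t : B → 𝓢(((Fin (n' + n')) → mixedSpace (Fp L)), ℂ))
    (hdom : ∀ s : Finset B, ∃ V' : Submodule ℂ 𝓢(((Fin (n' + n')) → mixedSpace (Fp L)), ℂ),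
      FiniteDimensional ℂ V' ∧ IsArchStable L e dV hdV hdV0 dW hdW hdW0 eW e' dV' hdV' hdV'0 χb hχbu hχbs 𝒦 V' ∧ ∀ β ∈ s, t β ∈ V')
    (hpartner : ∀ (V : Submodule ℂ 𝓢(((Fin (n' + n')) → mixedSpace (Fp L)), ℂ)), FiniteDimensional ℂ V → IsArchStable L e dV hdV hdV0 dW hdW hdW0 eW e' dV' hdV' hdV'0 χb hχbu hχbs 𝒦 V →
      ∀ a ∈ V, ∀ f : FinSB (Fp L) (Fin (n' + n')), ∃ w ∈ Submodule.span ℂ (Set.range t),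
        genFamily L e dV hdV hdV0 dW hdW hdW0 eW e' dV' hdV' hdV'0 χb hχbu hχbs α 𝒦 (piSchwartzBruhatEquiv (Fp L) (Fin (n' + n')) (w ⊗ₜ[ℂ] f)) =
          genFamily L e dV hdV hdV0 dW hdW hdW0 eW e' dV' hdV' hdV'0 χb hχbu hχbs α 𝒦 (piSchwartzBruhatEquiv (Fp L) (Fin (n' + n')) (a ⊗ₜ[ℂ] f)))
    (hgen : ∀ (β : B) (f : FinSB (Fp L) (Fin (n' + n'))) (V' : Submodule ℂ 𝓢(((Fin (n' + n')) → mixedSpace (Fp L)), ℂ)), FiniteDimensional ℂ V' →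
      IsArchStable L e dV hdV hdV0 dW hdW hdW0 eW e' dV' hdV' hdV'0 χb hχbu hχbs 𝒦 V' →
      ∀ hx : piSchwartzBruhatEquiv (Fp L) (Fin (n' + n')) (t β ⊗ₜ[ℂ] f) ∈ Submodule.span ℂ {x : piSchwartzBruhat (Fp L) (Fin (n' + n')) |
          ∃ a ∈ V', ∃ f : FinSB (Fp L) (Fin (n' + n')), x = piSchwartzBruhatEquiv (Fp L) (Fin (n' + n')) (a ⊗ₜ[ℂ] f)},
        Good V' ⟨piSchwartzBruhatEquiv (Fp L) (Fin (n' + n')) (t β ⊗ₜ[ℂ] f), hx⟩) :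
    ∀ (V : Submodule ℂ 𝓢(((Fin (n' + n')) → mixedSpace (Fp L)), ℂ)), FiniteDimensional ℂ V → IsArchStable L e dV hdV hdV0 dW hdW hdW0 eW e' dV' hdV' hdV'0 χb hχbu hχbs 𝒦 V →
      ∀ x : ↥(Submodule.span ℂ {x : piSchwartzBruhat (Fp L) (Fin (n' + n')) |
          ∃ a ∈ V, ∃ f : FinSB (Fp L) (Fin (n' + n')), x = piSchwartzBruhatEquiv (Fp L) (Fin (n' + n')) (a ⊗ₜ[ℂ] f)}), Good V x := by
  intro V hVfd hVst x
  exact forall_good_of_generators (𝕜 := ℂ)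
    (fun (a : 𝓢(((Fin (n' + n')) → mixedSpace (Fp L)), ℂ)) (f : FinSB (Fp L) (Fin (n' + n'))) => piSchwartzBruhatEquiv (Fp L) (Fin (n' + n')) (a ⊗ₜ[ℂ] f))
    (fun V => FiniteDimensional ℂ V ∧ IsArchStable L e dV hdV hdV0 dW hdW hdW0 eW e' dV' hdV' hdV'0 χb hχbu hχbs 𝒦 V)
    (fun x => genFamily L e dV hdV hdV0 dW hdW hdW0 eW e' dV' hdV' hdV'0 χb hχbu hχbs α 𝒦 x) Good t
    (fun a b f => by simp only [TensorProduct.add_tmul, map_add])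
    (fun c a f => by simp only [← TensorProduct.smul_tmul', map_smul])
    hcongr (fun V h => hzero V h.1 h.2) (fun V h => hadd V h.1 h.2) (fun V h => hsmul V h.1 h.2)
    (fun s => by
      obtain ⟨V', h1, h2, h3⟩ := hdom s
      exact ⟨V', ⟨h1, h2⟩, h3⟩)
    (fun V h => hpartner V h.1 h.2) (fun β f V' h => hgen β f V' h.1 h.2) V ⟨hVfd, hVst⟩ x

end Letters

end Summit.HodgeConjecture.HodgeConjecture.Cruxes.HLiu418.K2LiuArchSWDataFinalPassage

end
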